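import Mathlib
import Summits.Ventures.PercRepro.TriangleCapThreeBelowOneTriangleA
import Summits.Ventures.PercRepro.TriangleCapEightThirteenE

/-!
# PercRepro — FOUR BELOW THE DIAGONAL, ONE TRIANGLE: THE PRIVATE-SET COUNT REFINED BY AN INDEPENDENT SET
(p3, gen 39; part 127)

Inside a triangle-free vertex set `A` with an independent subset `P` (a private set of the triangle) and
`R = A ∖ P`, the Mantel count `2 Σ_A d² ≤ |A| Q′` sharpens to
`2 Σ_A d² + 2 Σ_{y ∈ R} a_y (|P| − a_y) ≤ |A| Q′` with `a_y = degIn P y` (**`independent_set_count`**): an edge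
`x y`, `x ∈ P`, `y ∈ R`, has `d(x) + d(y) ≤ |A| − |P| + a_y`, the pairs inside `R` have `d(y) + d(y′) ≤ |A|`.
With the exact bookkeeping of the outer degrees (`Σ s d = Q′ − Σ_{outer} d`) this gives
**`one_triangle_count_private`**: `2 Σ_v d² + 2n² + 4n + 2q ≤ 2σ + 2nm + 8m + 2nq + 4 Σ_{outer} d + 2A_P`… in the form
`Σ_v d(v)² + 4 (k − 5) ≤ m k` whenever `σ + m + 2n + nq ≤ n² + q + 2 Σ_{outer} d + A_P + 8`
(**`one_triangle_stability_four_of_private`**), `A_P = Σ_{y ∈ Sᶜ ∖ P} a_y (|P| − a_y)` for the private set `P` of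
any vertex of the triangle.  Axioms: standard.
-/

namespace PercRepro

namespace TriangleCap

namespace C047

open Finset

variable {V : Type*} [Fintype V] [DecidableEq V]

omit [Fintype V] in
/-- **THE INDEPENDENT-SET COUNT:** `A` triangle-free, `P ⊆ A` independent, `R = A ∖ P` ⇒
`2 Σ_{x ∈ A} degIn A x² + 2 Σ_{y ∈ R} degIn P y · |P| ≤ |A| · Σ_{x ∈ A} degIn A x + 2 Σ_{y ∈ R} degIn P y²`. -/
theorem independent_set_count (D : SimpleGraph V) [DecidableRel D.Adj] (A P : Finset V) (hPA : P ⊆ A)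
    (hnotri : ∀ y ∈ A, ∀ y' ∈ A, ∀ t ∈ A, D.Adj y y' → D.Adj y t → D.Adj y' t → False)
    (hPind : ∀ x ∈ P, ∀ x' ∈ P, ¬ D.Adj x x') :
    2 * ∑ x ∈ A, degIn D A x * degIn D A x + 2 * ∑ y ∈ A \ P, degIn D P y * P.card ≤
      A.card * ∑ x ∈ A, degIn D A x + 2 * ∑ y ∈ A \ P, degIn D P y * degIn D P y := by
  set R := A \ P with hR
  have hAR : A = P ∪ R := by rw [hR, union_sdiff_of_subset hPA]
  have hdPR : Disjoint P R := disjoint_sdiff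
  -- the pointwise bounds
  have hdisjN : ∀ y ∈ A, ∀ y' ∈ A, D.Adj y y' →
      Disjoint (A.filter (fun t => D.Adj y t)) (A.filter (fun t => D.Adj y' t)) := by
    intro y hy y' hy' hyy'
    rw [disjoint_left]
    intro t h1 h2
    rw [mem_filter] at h1 h2
    exact hnotri y hy y' hy' t h1.1 hyy' h1.2 h2.2
  have hMantel : ∀ y ∈ A, ∀ y' ∈ A, D.Adj y y' → degIn D A y + degIn D A y' ≤ A.card := by
    intro y hy y' hy' hyy'
    have := card_le_card (union_subset (filter_subset _ _) (filter_subset _ _) :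
      A.filter (fun t => D.Adj y t) ∪ A.filter (fun t => D.Adj y' t) ⊆ A)
    rw [card_union_of_disjoint (hdisjN y hy y' hy' hyy')] at this
    exact this
  -- `x ∈ P`, `y ∈ R` adjacent: `d(x) + d(y) + |P| ≤ |A| + a_y`
  have hPR : ∀ x ∈ P, ∀ y ∈ R, D.Adj x y → degIn D A x + degIn D A y + P.card ≤ A.card + degIn D P y := by
    intro x hx y hy hxy
    have hxA : x ∈ A := hPA hx
    have hyA : y ∈ A := (sdiff_subset) hy
    -- `N(x) ∩ A ⊆ R`, `N(y) ∩ A = (N(y) ∩ P) ∪ (N(y) ∩ R)`, the three sets `N(x) ∩ R`, `N(y) ∩ R`, `P ∖ N(y)` disjoint in `A`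
    have h1 : degIn D A x = degIn D R x := by
      unfold degIn
      congr 1
      ext t
      rw [mem_filter, mem_filter, hR, mem_sdiff]
      constructor
      · rintro ⟨ht, hxt⟩
        exact ⟨⟨ht, fun htP => hPind x hx t htP hxt⟩, hxt⟩
      · rintro ⟨⟨ht, -⟩, hxt⟩
        exact ⟨ht, hxt⟩
    have h2 : degIn D A y = degIn D P y + degIn D R y := by
      rw [hAR, degIn_union_of_disjoint D hdPR]
    have hsub : R.filter (fun t => D.Adj x t) ∪ R.filter (fun t => D.Adj y t) ⊆ R :=
      union_subset (filter_subset _ _) (filter_subset _ _)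
    have hd1 : Disjoint (R.filter (fun t => D.Adj x t)) (R.filter (fun t => D.Adj y t)) := by
      rw [disjoint_left]
      intro t h1' h2'
      rw [mem_filter] at h1' h2'
      exact hnotri x hxA y hyA t (sdiff_subset h1'.1) hxy h1'.2 h2'.2
    have hcard := card_le_card hsub
    rw [card_union_of_disjoint hd1] at hcard
    have hRcard : R.card + P.card = A.card := by
      rw [hR, card_sdiff_add_card_eq_card hPA]
    unfold degIn at h1 h2 ⊢
    omega
  -- the double sums
  have hsum : (∑ y ∈ A, ∑ y' ∈ A, if D.Adj y y' then degIn D A y else 0) +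
      (∑ y ∈ A, ∑ y' ∈ A, if D.Adj y y' then degIn D A y' else 0) +
      (2 * ∑ y ∈ R, degIn D P y * P.card) ≤
      (∑ y ∈ A, ∑ y' ∈ A, if D.Adj y y' then A.card else 0) + 2 * ∑ y ∈ R, degIn D P y * degIn D P y := by
    -- split both coordinates into `P` and `R`
    have hsplit : ∀ f : V → V → ℕ, ∑ y ∈ A, ∑ y' ∈ A, f y y' =
        ∑ y ∈ P, ∑ y' ∈ P, f y y' + ∑ y ∈ P, ∑ y' ∈ R, f y y' + ∑ y ∈ R, ∑ y' ∈ P, f y y' +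
          ∑ y ∈ R, ∑ y' ∈ R, f y y' := by
      intro f
      rw [hAR, sum_union hdPR]
      have e1 : ∑ y ∈ P, ∑ y' ∈ P ∪ R, f y y' = ∑ y ∈ P, ∑ y' ∈ P, f y y' + ∑ y ∈ P, ∑ y' ∈ R, f y y' := by
        rw [← sum_add_distrib]; apply sum_congr rfl; intro y _; rw [sum_union hdPR]
      have e2 : ∑ y ∈ R, ∑ y' ∈ P ∪ R, f y y' = ∑ y ∈ R, ∑ y' ∈ P, f y y' + ∑ y ∈ R, ∑ y' ∈ R, f y y' := by
        rw [← sum_add_distrib]; apply sum_congr rfl; intro y _; rw [sum_union hdPR]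
      rw [e1, e2]
      ring
    -- no pairs inside `P`
    have hPP : ∀ g : V → ℕ, ∑ y ∈ P, ∑ y' ∈ P, (if D.Adj y y' then g y' else 0) = 0 := by
      intro g
      apply sum_eq_zero; intro y hy; apply sum_eq_zero; intro y' hy'
      simp only [hPind y hy y' hy', if_false]
    have hPP' : ∀ g : V → ℕ, ∑ y ∈ P, ∑ y' ∈ P, (if D.Adj y y' then g y else 0) = 0 := by
      intro g
      apply sum_eq_zero; intro y hy; apply sum_eq_zero; intro y' hy'
      simp only [hPind y hy y' hy', if_false]
    -- the `P × R` block: `d(x) + d(y) ≤ |A| − |P| + a_y`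
    have hPRsum : (∑ x ∈ P, ∑ y ∈ R, if D.Adj x y then degIn D A x else 0) +
        (∑ x ∈ P, ∑ y ∈ R, if D.Adj x y then degIn D A y else 0) + ∑ y ∈ R, degIn D P y * P.card ≤
        (∑ x ∈ P, ∑ y ∈ R, if D.Adj x y then A.card else 0) + ∑ y ∈ R, degIn D P y * degIn D P y := by
      have e1 : ∑ y ∈ R, degIn D P y * P.card = ∑ x ∈ P, ∑ y ∈ R, if D.Adj x y then P.card else 0 := by
        rw [double_sum_ite_right]
      have e2 : ∑ y ∈ R, degIn D P y * degIn D P y = ∑ x ∈ P, ∑ y ∈ R, if D.Adj x y then degIn D P y else 0 := by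
        rw [double_sum_ite_right]
      rw [e1, e2]
      have hpt : ∀ x ∈ P, (∑ y ∈ R, if D.Adj x y then degIn D A x else 0) +
          (∑ y ∈ R, if D.Adj x y then degIn D A y else 0) + (∑ y ∈ R, if D.Adj x y then P.card else 0) ≤
          (∑ y ∈ R, if D.Adj x y then A.card else 0) + ∑ y ∈ R, if D.Adj x y then degIn D P y else 0 := by
        intro x hx
        rw [← sum_add_distrib, ← sum_add_distrib, ← sum_add_distrib]
        apply sum_le_sum; intro y hy
        by_cases h : D.Adj x y
        · simp only [h, if_true]
          exact hPR x hx y hy h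
        · simp only [h, if_false, add_zero, le_refl]
      have := sum_le_sum hpt
      rw [sum_add_distrib, sum_add_distrib, sum_add_distrib] at this
      exact this
    -- the `R × P` block, by symmetry
    have hRPsum : (∑ y ∈ R, ∑ x ∈ P, if D.Adj y x then degIn D A y else 0) +
        (∑ y ∈ R, ∑ x ∈ P, if D.Adj y x then degIn D A x else 0) + ∑ y ∈ R, degIn D P y * P.card ≤
        (∑ y ∈ R, ∑ x ∈ P, if D.Adj y x then A.card else 0) + ∑ y ∈ R, degIn D P y * degIn D P y := by
      have e1 : ∑ y ∈ R, degIn D P y * P.card = ∑ y ∈ R, ∑ x ∈ P, if D.Adj y x then P.card else 0 := by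
        rw [double_sum_ite_left]
      have e2 : ∑ y ∈ R, degIn D P y * degIn D P y = ∑ y ∈ R, ∑ x ∈ P, if D.Adj y x then degIn D P y else 0 := by
        rw [double_sum_ite_left]
      rw [e1, e2]
      have hpt : ∀ y ∈ R, (∑ x ∈ P, if D.Adj y x then degIn D A y else 0) +
          (∑ x ∈ P, if D.Adj y x then degIn D A x else 0) + (∑ x ∈ P, if D.Adj y x then P.card else 0) ≤
          (∑ x ∈ P, if D.Adj y x then A.card else 0) + ∑ x ∈ P, if D.Adj y x then degIn D P y else 0 := by
        intro y hy
        rw [← sum_add_distrib, ← sum_add_distrib, ← sum_add_distrib]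
        apply sum_le_sum; intro x hx
        by_cases h : D.Adj y x
        · simp only [h, if_true]
          have := hPR x hx y hy h.symm
          omega
        · simp only [h, if_false, add_zero, le_refl]
      have := sum_le_sum hpt
      rw [sum_add_distrib, sum_add_distrib, sum_add_distrib] at this
      exact this
    -- the `R × R` block: Mantel
    have hRRsum : (∑ y ∈ R, ∑ y' ∈ R, if D.Adj y y' then degIn D A y else 0) +
        (∑ y ∈ R, ∑ y' ∈ R, if D.Adj y y' then degIn D A y' else 0) ≤
        ∑ y ∈ R, ∑ y' ∈ R, if D.Adj y y' then A.card else 0 := by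
      rw [← sum_add_distrib]
      apply sum_le_sum; intro y hy
      rw [← sum_add_distrib]
      apply sum_le_sum; intro y' hy'
      by_cases h : D.Adj y y'
      · simp only [h, if_true]
        exact hMantel y (sdiff_subset hy) y' (sdiff_subset hy') h
      · simp only [h, if_false, add_zero, le_refl]
    rw [hsplit (fun y y' => if D.Adj y y' then degIn D A y else 0),
      hsplit (fun y y' => if D.Adj y y' then degIn D A y' else 0),
      hsplit (fun y y' => if D.Adj y y' then A.card else 0), hPP', hPP, hPP' (fun _ => A.card)]
    simp only [zero_add]
    omega
  rw [double_sum_ite_left, double_sum_ite_right, double_sum_ite_left] at hsum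
  have e : ∑ y ∈ A, degIn D A y * A.card = A.card * ∑ y ∈ A, degIn D A y := by
    rw [mul_sum]; apply sum_congr rfl; intro y _; ring
  omega

/-- The private set of `u` in the one-triangle setting is independent. -/
theorem priv_indep (D : SimpleGraph V) [DecidableRel D.Adj] {u v w : V}
    (hT : ∀ a b c, D.Adj a b → D.Adj a c → D.Adj b c → a = u ∨ a = v ∨ a = w) :
    ∀ x ∈ (({u, v, w} : Finset V)ᶜ).filter (fun x => D.Adj u x),
      ∀ x' ∈ (({u, v, w} : Finset V)ᶜ).filter (fun x => D.Adj u x), ¬ D.Adj x x' := by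
  intro x hx x' hx' hxx'
  rw [mem_filter, mem_compl] at hx hx'
  simp only [mem_insert, mem_singleton, not_or] at hx hx'
  rcases hT x x' u hxx' hx.2.symm hx'.2.symm with h | h | h
  · exact hx.1.1 h
  · exact hx.1.2.1 h
  · exact hx.1.2.2 h

/-- **THE PRIVATE-SET COUNT REFINED:** one triangle `S = {u, v, w}`, every degree `≥ 2`, `P` the private set of
`u`, `R = Sᶜ ∖ P`, `a_y = degIn P y` ⇒
`2 Σ_v d² + 2 Σ_{R} a_y |P| + 4 Σ_{outer} d + 4n + 2q + 2n² ≤ 2σ + 2nm + 8m + 2nq + 2 Σ_R a_y²`. -/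
theorem one_triangle_count_private (D : SimpleGraph V) [DecidableRel D.Adj] (hK : K4mFree D)
    {u v w : V} (huv : D.Adj u v) (huw : D.Adj u w) (hvw : D.Adj v w)
    (hT : ∀ a b c, D.Adj a b → D.Adj a c → D.Adj b c → a = u ∨ a = v ∨ a = w) :
    2 * ∑ v, deg D v * deg D v +
        2 * ∑ y ∈ ({u, v, w} : Finset V)ᶜ \ (({u, v, w} : Finset V)ᶜ).filter (fun x => D.Adj u x),
          degIn D ((({u, v, w} : Finset V)ᶜ).filter (fun x => D.Adj u x)) y *
            ((({u, v, w} : Finset V)ᶜ).filter (fun x => D.Adj u x)).card +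
        4 * ∑ z ∈ (({u, v, w} : Finset V)ᶜ).filter (fun z => degIn D {u, v, w} z = 0),
          degIn D ({u, v, w} : Finset V)ᶜ z +
        4 * (({u, v, w} : Finset V)ᶜ).card +
        2 * ((({u, v, w} : Finset V)ᶜ).filter (fun z => degIn D {u, v, w} z = 0)).card +
        2 * ((({u, v, w} : Finset V)ᶜ).card * (({u, v, w} : Finset V)ᶜ).card) ≤
      2 * ∑ x ∈ ({u, v, w} : Finset V), degIn D ({u, v, w} : Finset V)ᶜ x * degIn D ({u, v, w} : Finset V)ᶜ x +
        2 * ((({u, v, w} : Finset V)ᶜ).card * D.edgeFinset.card) + 8 * D.edgeFinset.card +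
        2 * ((({u, v, w} : Finset V)ᶜ).card *
          ((({u, v, w} : Finset V)ᶜ).filter (fun z => degIn D {u, v, w} z = 0)).card) +
        2 * ∑ y ∈ ({u, v, w} : Finset V)ᶜ \ (({u, v, w} : Finset V)ᶜ).filter (fun x => D.Adj u x),
          degIn D ((({u, v, w} : Finset V)ᶜ).filter (fun x => D.Adj u x)) y *
            degIn D ((({u, v, w} : Finset V)ᶜ).filter (fun x => D.Adj u x)) y := by
  set S : Finset V := {u, v, w} with hS
  set P : Finset V := Sᶜ.filter (fun x => D.Adj u x) with hP
  have h3 : S.card = 3 := card_triple huv.ne huw.ne hvw.ne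
  have hcl := clique_triple D huv huw hvw
  have hone : ∀ z ∈ Sᶜ, degIn D S z ≤ 1 := fun z hz => degIn_le_one_of_triangle D hK huv huw hvw (mem_compl.mp hz)
  have hnotri : ∀ y ∈ Sᶜ, ∀ y' ∈ Sᶜ, ∀ t ∈ Sᶜ, D.Adj y y' → D.Adj y t → D.Adj y' t → False := by
    intro y hy y' _ t _ hyy' hyt _
    rw [mem_compl, hS] at hy
    simp only [mem_insert, mem_singleton, not_or] at hy
    rcases hT y y' t hyy' hyt (by assumption) with h | h | h
    · exact hy.1 h
    · exact hy.2.1 h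
    · exact hy.2.2 h
  have hPA : P ⊆ Sᶜ := filter_subset _ _
  have hPind := priv_indep D hT
  have hcount := independent_set_count D Sᶜ P hPA hnotri hPind
  -- the density
  have hdens := two_mul_card_edges_eq_adjPairs_add D S
  have hQ6 : adjPairs D S = 6 := by
    rw [adjPairs_eq_sum_degIn]
    calc ∑ x ∈ S, degIn D S x = ∑ _x ∈ S, 2 := sum_congr rfl (fun x hx => degIn_self_of_clique D h3 hcl hx)
      _ = 6 := by rw [sum_const, h3, smul_eq_mul]
  rw [hQ6] at hdens
  have hsq := sum_degIn_mul_add_sum_outer D S hone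
  have hsum_s : ∑ z ∈ Sᶜ, degIn D S z + (Sᶜ.filter (fun z => degIn D S z = 0)).card = Sᶜ.card := by
    have hc := card_filter_add_card_filter_not (fun z => degIn D S z = 0) (s := Sᶜ)
    have h1 : ∑ z ∈ Sᶜ, degIn D S z = (Sᶜ.filter (fun z => ¬ degIn D S z = 0)).card := by
      rw [card_eq_sum_ones, sum_filter]
      apply sum_congr rfl
      intro z hz
      have := hone z hz
      by_cases h0 : degIn D S z = 0
      · simp only [h0, not_true_eq_false, if_false]
      · simp only [h0, not_false_eq_true, if_true]; omega
    omega
  have hsplit := sum_add_sum_compl S (fun v => deg D v * deg D v)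
  have hS_sum : ∑ x ∈ S, deg D x * deg D x =
      12 + 4 * ∑ x ∈ S, degIn D Sᶜ x + ∑ x ∈ S, degIn D Sᶜ x * degIn D Sᶜ x := by
    have e : ∀ x ∈ S, deg D x * deg D x = 4 + 4 * degIn D Sᶜ x + degIn D Sᶜ x * degIn D Sᶜ x := by
      intro x hx
      rw [deg_eq_degIn_add_degIn_compl D S x, degIn_self_of_clique D h3 hcl hx]
      ring
    rw [sum_congr rfl e, sum_add_distrib, sum_add_distrib, sum_const, h3, smul_eq_mul, mul_sum]
  have hSc_sum : ∑ x ∈ Sᶜ, deg D x * deg D x =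
      ∑ x ∈ Sᶜ, degIn D S x + 2 * ∑ x ∈ Sᶜ, degIn D S x * degIn D Sᶜ x +
        ∑ x ∈ Sᶜ, degIn D Sᶜ x * degIn D Sᶜ x := by
    have e : ∀ x ∈ Sᶜ, deg D x * deg D x =
        degIn D S x + 2 * (degIn D S x * degIn D Sᶜ x) + degIn D Sᶜ x * degIn D Sᶜ x := by
      intro x hx
      rw [deg_eq_degIn_add_degIn_compl D S x]
      have h1 := hone x hx
      have hs : degIn D S x * degIn D S x = degIn D S x := by
        rcases Nat.le_one_iff_eq_zero_or_eq_one.mp h1 with h | h <;> rw [h]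
      nlinarith [hs]
    rw [sum_congr rfl e, sum_add_distrib, sum_add_distrib, mul_sum]
  have hcomm := sum_degIn_comm D S Sᶜ
  rw [← hsplit, hS_sum, hSc_sum, hcomm]
  nlinarith [hcount, hdens, hsq, hsum_s]

/-- **FOUR BELOW THE DIAGONAL, ONE TRIANGLE, BY THE PRIVATE SET OF `u`:** one triangle `S = {u, v, w}`, and
`σ + m + 2n + nq + Σ_R a_y² ≤ Σ_R a_y |P| + 2 Σ_{outer} d + q + n² + 8` ⇒ `Σ_v d(v)² + 4 (k − 5) ≤ m k`. -/
theorem one_triangle_stability_four_of_private (D : SimpleGraph V) [DecidableRel D.Adj] (hK : K4mFree D)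
    {u v w : V} (huv : D.Adj u v) (huw : D.Adj u w) (hvw : D.Adj v w)
    (hT : ∀ a b c, D.Adj a b → D.Adj a c → D.Adj b c → a = u ∨ a = v ∨ a = w) (hk : 10 ≤ Fintype.card V)
    (hcond : ∑ x ∈ ({u, v, w} : Finset V), degIn D ({u, v, w} : Finset V)ᶜ x * degIn D ({u, v, w} : Finset V)ᶜ x +
      D.edgeFinset.card + 2 * (({u, v, w} : Finset V)ᶜ).card +
      (({u, v, w} : Finset V)ᶜ).card * ((({u, v, w} : Finset V)ᶜ).filter (fun z => degIn D {u, v, w} z = 0)).card +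
      ∑ y ∈ ({u, v, w} : Finset V)ᶜ \ (({u, v, w} : Finset V)ᶜ).filter (fun x => D.Adj u x),
        degIn D ((({u, v, w} : Finset V)ᶜ).filter (fun x => D.Adj u x)) y *
          degIn D ((({u, v, w} : Finset V)ᶜ).filter (fun x => D.Adj u x)) y ≤
      ∑ y ∈ ({u, v, w} : Finset V)ᶜ \ (({u, v, w} : Finset V)ᶜ).filter (fun x => D.Adj u x),
        degIn D ((({u, v, w} : Finset V)ᶜ).filter (fun x => D.Adj u x)) y *
          ((({u, v, w} : Finset V)ᶜ).filter (fun x => D.Adj u x)).card +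
      2 * ∑ z ∈ (({u, v, w} : Finset V)ᶜ).filter (fun z => degIn D {u, v, w} z = 0),
        degIn D ({u, v, w} : Finset V)ᶜ z +
      ((({u, v, w} : Finset V)ᶜ).filter (fun z => degIn D {u, v, w} z = 0)).card +
      (({u, v, w} : Finset V)ᶜ).card * (({u, v, w} : Finset V)ᶜ).card + 8) :
    ∑ v, deg D v * deg D v + 4 * (Fintype.card V - 5) ≤ D.edgeFinset.card * Fintype.card V := by
  have hcount := one_triangle_count_private D hK huv huw hvw hT
  have hkn : Fintype.card V = (({u, v, w} : Finset V)ᶜ).card + 3 := by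
    rw [card_compl, card_triple huv.ne huw.ne hvw.ne]
    have : ({u, v, w} : Finset V).card ≤ Fintype.card V := card_le_univ _
    rw [card_triple huv.ne huw.ne hvw.ne] at this
    omega
  rw [hkn] at hk ⊢
  obtain ⟨n, hn⟩ : ∃ n, (({u, v, w} : Finset V)ᶜ).card = n := ⟨_, rfl⟩
  rw [hn] at hcount hcond hk ⊢
  obtain ⟨q, hq⟩ : ∃ q, ((({u, v, w} : Finset V)ᶜ).filter (fun z => degIn D {u, v, w} z = 0)).card = q := ⟨_, rfl⟩
  rw [hq] at hcount hcond
  obtain ⟨σ, hσ⟩ : ∃ σ, ∑ x ∈ ({u, v, w} : Finset V), degIn D ({u, v, w} : Finset V)ᶜ x *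
      degIn D ({u, v, w} : Finset V)ᶜ x = σ := ⟨_, rfl⟩
  rw [hσ] at hcount hcond
  obtain ⟨B, hB⟩ : ∃ B, ∑ y ∈ ({u, v, w} : Finset V)ᶜ \ (({u, v, w} : Finset V)ᶜ).filter (fun x => D.Adj u x),
      degIn D ((({u, v, w} : Finset V)ᶜ).filter (fun x => D.Adj u x)) y *
        ((({u, v, w} : Finset V)ᶜ).filter (fun x => D.Adj u x)).card = B := ⟨_, rfl⟩
  obtain ⟨C, hC⟩ : ∃ C, ∑ y ∈ ({u, v, w} : Finset V)ᶜ \ (({u, v, w} : Finset V)ᶜ).filter (fun x => D.Adj u x),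
      degIn D ((({u, v, w} : Finset V)ᶜ).filter (fun x => D.Adj u x)) y *
        degIn D ((({u, v, w} : Finset V)ᶜ).filter (fun x => D.Adj u x)) y = C := ⟨_, rfl⟩
  obtain ⟨Dout, hD⟩ : ∃ Dout, ∑ z ∈ (({u, v, w} : Finset V)ᶜ).filter (fun z => degIn D {u, v, w} z = 0),
      degIn D ({u, v, w} : Finset V)ᶜ z = Dout := ⟨_, rfl⟩
  rw [hB, hC, hD] at hcount hcond
  obtain ⟨n', rfl⟩ : ∃ n', n = n' + 7 := ⟨n - 7, by omega⟩
  have e : n' + 7 + 3 - 5 = n' + 5 := by omega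
  rw [e]
  nlinarith [hcount, hcond]

end C047

end TriangleCap

end PercRepro
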